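import Literature.Computability.Complexity.HardcoreInapproximability
import Literature.Computability.Complexity.KarpCliqueGadget
import Literature.Computability.Complexity.KarpCliqueNP
import Literature.Computability.Complexity.CNFInvariance
import Literature.Computability.Cryptography.PseudorandomGeneratorsAnyOWF

/-!
# The counting window on conflict graphs of bounded-occurrence E3-CNFs
(stub `stub_conflictGraphGap` of line `prg-image-exact-threshold-lift`, crux
`Summit.PneNP.PneNP.Theses.PhaseTwins.PseudorandomTwinsAbove`, item stmt-PneNP-2721, step S4b)

For an E3-CNF `φ` with `m` clauses let `A = KarpClique.annot 0 φ` (annotated literal occurrences: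
clause number, variable numeral, polarity) and `G` the CONFLICT graph on the positions of `A`
(`p ~ q` iff same clause number and different variables, or same variable and opposite polarities:
Karp's 3SAT → INDEPENDENT-SET graph). `|A| = 3m` (`length_annot`); degrees are `≤ B + 3` when each
variable lies in `≤ B` clauses (`maxDegree_le`); a satisfying assignment gives an independent `m`-set
and an independent set satisfies `≥ |I|` clauses (Karp 1972 §4, read for the complement-inside-clauses
graph). With `Δ = B + 3`, `q = 1`, `p = 2^K` (`Kγ ≥ 6`, `K ≥ Δ`), `N = Σ_{I indep} 2^{K|I|}`: YES gives
`N ≥ 2^{Km} = 8 · 2^{Km-3}`, NO (`val φ ≤ 1-γ`) gives `0 < N ≤ 2^{3m+K(1-γ)m} ≤ 2^{Km-3}` (`window`);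
`λ_c(B+3) = (B+2)^{B+2}/(B+1)^{B+3} < 2^K`; `|code ⟨3m, G⟩| = 2|bin(3m)| + 2 + 9m²` (`encodingGraph_encode`,
`length_boolPair`, `CliqueNP.length_adjBits`) is strictly increasing in `m`.
-/

set_option linter.dupNamespace false -- `Summit.PneNP.PneNP.…`: summit = sub-problem (D-0017)

namespace Summit.PneNP.PneNP.Theorems

open Filter
open Literature.Computability.Complexity Literature.Computability.MetaComplexity
open Literature.Computability.Cryptography (OWFExist PRGExist IsPRG IsCompIndistinguishable uniformBits PRGExist_of_OWFExist)
open Literature.Probability.LatticeModels (hardCoreThreshold)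
open _root_.Computability

namespace ConflictGraphGap
open KarpClique Finset

/-- The number of positions of a list at which `P` holds is a `countP`. [folklore] -/
theorem card_filter_univ_eq_countP {α : Type*} (P : α → Prop) [DecidablePred P] :
    ∀ l : List α, (univ.filter fun i : Fin l.length => P l[i]).card = l.countP fun x => decide (P x)
  | [] => by simp
  | a :: l => by
    change (univ.filter fun i : Fin (l.length + 1) => P (a :: l)[(i : ℕ)]).card = _
    rw [Fin.card_filter_univ_succ', List.countP_cons, ← card_filter_univ_eq_countP P l]
    by_cases h : P a <;> simp [h, Nat.add_comm]

/-! ### The annotated occurrence list of an E3-CNF -/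

section Annot

variable {φ : CNF ℕ}

/-- `|annot k φ| = 3 |φ|` when every clause has exactly 3 literals. [folklore] -/
theorem length_annot (h3 : ∀ c ∈ φ, c.length = 3) (k : ℕ) : (annot k φ).length = 3 * φ.length := by
  induction φ generalizing k with
  | nil => simp [annot]
  | cons c φ ih =>
    rw [annot, List.length_append, List.length_map, ih (fun c' hc' => h3 c' (by simp [hc'])),
      h3 c (by simp), List.length_cons]
    ring

/-- A clause number is carried by at most 3 annotated occurrences (clauses of length 3). [folklore] -/
theorem countP_fst_annot_le (h3 : ∀ c ∈ φ, c.length = 3) (k i : ℕ) :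
    (annot k φ).countP (fun x => decide (x.1 = i)) ≤ 3 := by
  induction φ generalizing k with
  | nil => simp [annot]
  | cons c φ ih =>
    have hc : c.length = 3 := h3 c (by simp)
    rw [annot, if_neg (by rintro rfl; simp at hc), List.countP_append]
    by_cases hi : k + 1 = i
    · have h0 : (annot (k + 1) φ).countP (fun x => decide (x.1 = i)) = 0 :=
        List.countP_eq_zero.2 fun x hx => by
          have := (fst_mem_annot_bounds (k + 1) φ x hx).1; simp only [decide_eq_true_eq]; omega
      rw [h0, add_zero]
      exact List.countP_le_length.trans (by rw [List.length_map, hc])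
    · have h0 : (c.map (annLit (k + 1))).countP (fun x : Ann => decide (x.1 = i)) = 0 :=
        List.countP_eq_zero.2 fun x hx => by
          obtain ⟨l, -, rfl⟩ := List.mem_map.1 hx; simpa [annLit] using hi
      rw [h0, zero_add]
      exact ih (fun c' hc' => h3 c' (by simp [hc'])) (k + 1)

/-- A variable numeral is carried by at most as many annotated occurrences as there are clauses
containing the variable, when the variables of each clause are distinct. [folklore] -/
theorem countP_var_annot_le (hnd : ∀ c ∈ φ, (c.map Prod.fst).Nodup) (k v : ℕ) :
    (annot k φ).countP (fun x => decide (x.2.1 = encodeNat v)) ≤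
      φ.countP fun cl => decide (v ∈ cl.map Prod.fst) := by
  induction φ generalizing k with
  | nil => simp [annot]
  | cons c φ ih =>
    have hc : (c.map Prod.fst).Nodup := hnd c (by simp)
    have ih' := ih (fun c' hc' => hnd c' (by simp [hc'])) (if c = [] then k else k + 1)
    rw [annot, List.countP_append, List.countP_cons]
    have h1 : (c.map (annLit (k + 1))).countP (fun x : Ann => decide (x.2.1 = encodeNat v)) =
        (c.map Prod.fst).count v := by
      rw [List.countP_map, List.count_eq_countP, List.countP_map]
      exact List.countP_congr fun l _ => by simp [annLit, Brick.encodeNat_inj]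
    have h2 : (c.map Prod.fst).count v ≤ if decide (v ∈ c.map Prod.fst) = true then 1 else 0 := by
      split_ifs with hv
      · exact List.nodup_iff_count_le_one.1 hc v
      · exact (List.count_eq_zero.2 (by simpa using hv)).le
    rw [h1]
    omega

/-- The annotated occurrence list has no duplicates when the variables of each clause are distinct
(occurrences of one clause differ in the variable, of different clauses in the number). [folklore] -/
theorem nodup_annot (hnd : ∀ c ∈ φ, (c.map Prod.fst).Nodup) (k : ℕ) : (annot k φ).Nodup := by
  induction φ generalizing k with
  | nil => simp [annot]
  | cons c φ ih =>
    rw [annot, List.nodup_append]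
    refine ⟨((hnd c (by simp)).of_map _).map (fun l l' h => ?_),
      ih (fun c' hc' => hnd c' (by simp [hc'])) _, fun x hx y hy hxy => ?_⟩
    · simp only [annLit, Prod.mk.injEq] at h
      exact Prod.ext (by simpa using congrArg decodeNat h.2.1) h.2.2
    · subst hxy
      obtain ⟨l, hl, rfl⟩ := List.mem_map.1 hx
      rw [if_neg (List.ne_nil_of_mem hl)] at hy
      exact absurd (fst_mem_annot_bounds (k + 1) φ _ hy).1 (by simp [annLit])

end Annot

/-! ### Conflict graphs on an annotated occurrence list -/

section Graph

variable {A : List Ann} {φ : CNF ℕ} {G : SimpleGraph (Fin A.length)}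
  (hadj : ∀ p q : Fin A.length, G.Adj p q ↔ p ≠ q ∧
    ((A[p].1 = A[q].1 ∧ A[p].2.1 ≠ A[q].2.1) ∨ (A[p].2.1 = A[q].2.1 ∧ A[p].2.2 ≠ A[q].2.2)))

include hadj

open scoped Classical in
/-- **Maximum degree of a conflict graph**: adjacent positions share the clause number or the variable
numeral, carried by `≤ 3` resp. `≤ B` positions, so every degree is `≤ B + 3`. [folklore] -/
theorem maxDegree_le (B : ℕ) (h1 : ∀ p : Fin A.length, (A.countP fun x => decide (x.1 = A[p].1)) ≤ 3)
    (h2 : ∀ p : Fin A.length, (A.countP fun x => decide (x.2.1 = A[p].2.1)) ≤ B) :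
    G.maxDegree ≤ B + 3 := by
  refine G.maxDegree_le_of_forall_degree_le _ fun v => ?_
  rw [← SimpleGraph.card_neighborFinset_eq_degree, SimpleGraph.neighborFinset_eq_filter]
  calc _ ≤ ((univ.filter fun w : Fin A.length => A[w].2.1 = A[v].2.1) ∪
          (univ.filter fun w : Fin A.length => A[w].1 = A[v].1)).card := by
        refine card_le_card fun w hw => ?_
        obtain ⟨-, h | h⟩ := (hadj v w).1 (mem_filter.1 hw).2
        · exact mem_union_right _ (mem_filter.2 ⟨mem_univ _, h.1.symm⟩)
        · exact mem_union_left _ (mem_filter.2 ⟨mem_univ _, h.1.symm⟩)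
    _ ≤ _ := card_union_le _ _
    _ ≤ B + 3 := by
        rw [card_filter_univ_eq_countP (fun x : Ann => x.2.1 = A[v].2.1) A,
          card_filter_univ_eq_countP (fun x : Ann => x.1 = A[v].1) A]
        exact Nat.add_le_add (h2 v) (h1 v)

/-- **YES: a satisfying assignment gives an independent `|φ|`-set** — one true literal per clause: their
occurrences have distinct clause numbers and are never complementary. [cite: Karp1972, §4] -/
theorem exists_indepSet_of_satisfiable
    (hmem : ∀ x : Ann, x ∈ A ↔ ∃ (i : ℕ) (_ : i < φ.length), ∃ l ∈ φ[i], x = annLit (i + 1) l)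
    (hsat : φ.Satisfiable) :
    ∃ I : Finset (Fin A.length), G.IsIndepSet ↑I ∧ I.card = φ.length := by
  obtain ⟨σ, hσ⟩ := hsat
  rw [CNF.eval_eq_true_iff] at hσ
  have hlit : ∀ i : Fin φ.length, ∃ l ∈ φ[i], Literal.eval σ l = true := fun i =>
    (clause_eval_eq_true_iff σ _).1 (hσ _ (List.getElem_mem i.isLt))
  choose lit hlit_mem hlit_true using hlit
  have hposEx : ∀ i : Fin φ.length, ∃ p : Fin A.length, A[p] = annLit (i + 1) (lit i) := fun i => by
    obtain ⟨p, hp, hpe⟩ := List.mem_iff_getElem.1 ((hmem _).2 ⟨i, i.isLt, lit i, hlit_mem i, rfl⟩)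
    exact ⟨⟨p, hp⟩, hpe⟩
  choose pos hpos using hposEx
  have hinj : Function.Injective pos := fun i j hij => by
    have e := congrArg (fun p => (A[p]).1) hij
    simp only [hpos, annLit] at e; exact Fin.ext (by omega)
  refine ⟨univ.image pos, ?_, by rw [card_image_of_injective _ hinj, card_univ, Fintype.card_fin]⟩
  rw [SlyReduction.isIndepSet_coe_finset_iff]
  intro a ha b hb hab
  simp only [mem_image, mem_univ, true_and] at ha hb
  obtain ⟨i, rfl⟩ := ha
  obtain ⟨j, rfl⟩ := hb
  obtain ⟨hne, h | h⟩ := (hadj _ _).1 hab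
  · exact hne (congrArg pos (Fin.ext (by have e := h.1; simp only [hpos, annLit] at e; omega)))
  · obtain ⟨hv, hb⟩ := h
    simp only [hpos, annLit] at hv hb
    have e1 := hlit_true i
    have e2 := hlit_true j
    simp only [Literal.eval, beq_iff_eq] at e1 e2
    exact hb (by rw [← e1, ← e2, show (lit i).1 = (lit j).1 by simpa using congrArg decodeNat hv])

/-- **NO: an independent set satisfies at least `|I|` clauses.** Its members carry pairwise distinct
clause numbers (same number forces same variable, then same polarity, then — no duplicates — the same
position) and no complementary pair: making their literals true satisfies their clauses.
[cite: Karp1972, §4 (SATISFIABILITY ∝ CLIQUE)] -/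
theorem card_le_countP_of_isIndepSet
    (hmem : ∀ x : Ann, x ∈ A ↔ ∃ (i : ℕ) (_ : i < φ.length), ∃ l ∈ φ[i], x = annLit (i + 1) l)
    (hnd : A.Nodup) (I : Finset (Fin A.length)) (hI : G.IsIndepSet ↑I) :
    ∃ σ : ℕ → Bool, I.card ≤ φ.countP fun c => c.eval σ := by
  classical
  rw [SlyReduction.isIndepSet_coe_finset_iff] at hI
  have hfst : ∀ p : Fin A.length, ∃ (i : ℕ) (_ : i < φ.length), ∃ l ∈ φ[i], A[p] = annLit (i + 1) l :=
    fun p => (hmem _).1 (show A[p] ∈ A by rw [Fin.getElem_fin]; exact List.getElem_mem p.isLt)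
  have hnc : ∀ p ∈ I, ∀ q ∈ I, p ≠ q →
      (A[p].1 = A[q].1 → A[p].2.1 = A[q].2.1) ∧ (A[p].2.1 = A[q].2.1 → A[p].2.2 = A[q].2.2) := by
    intro p hp q hq hpq
    have h : ¬ G.Adj p q := hI p hp q hq
    rw [hadj] at h
    exact ⟨fun h1 => by_contra fun h2 => h ⟨hpq, Or.inl ⟨h1, h2⟩⟩,
      fun h1 => by_contra fun h2 => h ⟨hpq, Or.inr ⟨h1, h2⟩⟩⟩
  let σ : ℕ → Bool := fun v => decide (∃ p ∈ I, (A[p]).2 = (encodeNat v, true))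
  -- the clause of every member is satisfied by `σ`
  have hsatcl : ∀ p ∈ I, ∃ (i : ℕ) (_ : i < φ.length),
      (A[p]).1 = i + 1 ∧ Clause.eval σ (φ[i]) = true := by
    intro p hp
    obtain ⟨i, hi, l, hl, hpl⟩ := hfst p
    refine ⟨i, hi, by simp [hpl, annLit], (clause_eval_eq_true_iff σ _).2 ⟨l, hl, ?_⟩⟩
    rw [Literal.eval, beq_iff_eq]
    cases hb : l.2
    · simp only [σ, decide_eq_false_iff_not]
      rintro ⟨q, hq, hq2⟩
      have hp2 : (A[p]).2 = (encodeNat l.1, false) := by simp [hpl, annLit, hb]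
      have hpq : p ≠ q := by rintro rfl; rw [hp2] at hq2; simp at hq2
      have h := (hnc p hp q hq hpq).2
      rw [hp2, hq2] at h
      simp at h
    · exact decide_eq_true ⟨p, hp, by simp [hpl, annLit, hb]⟩
  -- clause numbers are injective on `I`, and land in the satisfied clauses
  have hinj : Set.InjOn (fun p : Fin A.length => (A[p]).1 - 1) ↑I := by
    intro p hp q hq hpq
    rw [Finset.mem_coe] at hp hq
    obtain ⟨i, -, hp1, -⟩ := hsatcl p hp
    obtain ⟨j, -, hq1, -⟩ := hsatcl q hq
    have h1 : (A[p]).1 = (A[q]).1 := by dsimp only at hpq; omega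
    by_contra hne
    have h2 := (hnc p hp q hq hne).1 h1
    have heq : A[(p : ℕ)] = A[(q : ℕ)] := Prod.ext h1 (Prod.ext h2 ((hnc p hp q hq hne).2 h2))
    exact hne (Fin.ext ((hnd.getElem_inj_iff).1 heq))
  have hmaps : Set.MapsTo (fun p : Fin A.length => (A[p]).1 - 1) ↑I
      ↑((univ.filter fun i : Fin φ.length => Clause.eval σ (φ[i]) = true).image Fin.val) := by
    intro p hp
    obtain ⟨i, hi, h1, h2⟩ := hsatcl p (Finset.mem_coe.1 hp)
    rw [Finset.mem_coe, mem_image]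
    exact ⟨⟨i, hi⟩, mem_filter.2 ⟨mem_univ _, h2⟩, by dsimp only; omega⟩
  refine ⟨σ, (card_le_card_of_injOn _ hmaps hinj).trans ?_⟩
  rw [card_image_of_injective _ Fin.val_injective,
    card_filter_univ_eq_countP (fun c => Clause.eval σ c = true) φ]
  simp only [Bool.decide_eq_true, le_refl]

end Graph

/-! ### The two ends of the counting window -/

open scoped Classical in
/-- The term of one independent set is below the hard-core count. [folklore] -/
theorem term_le_sum {n : ℕ} (G : SimpleGraph (Fin n)) (p q : ℕ) (I : Finset (Fin n))
    (hI : G.IsIndepSet ↑I) : p ^ I.card * q ^ (n - I.card) ≤ ∑ J : Finset (Fin n),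
      (if G.IsIndepSet (↑J : Set (Fin n)) then p ^ J.card * q ^ (n - J.card) else 0) := by
  have h := Finset.single_le_sum (f := fun J : Finset (Fin n) =>
      if G.IsIndepSet (↑J : Set (Fin n)) then p ^ J.card * q ^ (n - J.card) else 0)
    (fun J _ => Nat.zero_le _) (Finset.mem_univ I)
  rwa [if_pos hI] at h

open scoped Classical in
/-- The hard-core count at `q = 1` is at most (number of vertex sets) × (largest term). [folklore] -/
theorem sum_le {n : ℕ} (G : SimpleGraph (Fin n)) (p s : ℕ) (hp : 1 ≤ p)
    (hs : ∀ I : Finset (Fin n), G.IsIndepSet ↑I → I.card ≤ s) :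
    ∑ J : Finset (Fin n), (if G.IsIndepSet (↑J : Set (Fin n)) then p ^ J.card * 1 ^ (n - J.card) else 0)
      ≤ 2 ^ n * p ^ s := by
  calc _ ≤ (univ : Finset (Finset (Fin n))).card • p ^ s :=
        Finset.sum_le_card_nsmul _ _ _ fun J _ => ?_
    _ = 2 ^ n * p ^ s := by rw [card_univ, Fintype.card_finset, Fintype.card_fin, smul_eq_mul]
  split_ifs with hJ
  · rw [one_pow, mul_one]; exact Nat.pow_le_pow_right hp (hs J hJ)
  · exact Nat.zero_le _

/-! ### Parameters: threshold and code length -/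

/-- `λ_c(B+3) = (B+2)^{B+2}/(B+1)^{B+3} < 2^K` for `K ≥ B + 3`. [folklore] -/
theorem threshold_lt (B K : ℕ) (hK : B + 3 ≤ K) :
    hardCoreThreshold (B + 3) < ((2 ^ K : ℕ) : ℝ) / ((1 : ℕ) : ℝ) := by
  have hnat : (B + 2) ^ (B + 2) < 2 ^ K * (B + 1) ^ (B + 3) :=
    calc (B + 2) ^ (B + 2) ≤ (2 * (B + 1)) ^ (B + 2) := Nat.pow_le_pow_left (by omega) _
      _ = 2 ^ (B + 2) * (B + 1) ^ (B + 2) := mul_pow _ _ _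
      _ < 2 ^ (B + 3) * (B + 1) ^ (B + 3) :=
          Nat.mul_lt_mul_of_lt_of_le (Nat.pow_lt_pow_right (by norm_num) (by omega))
            (Nat.pow_le_pow_right (by omega) (by omega)) (by positivity)
      _ ≤ 2 ^ K * (B + 1) ^ (B + 3) := Nat.mul_le_mul_right _ (Nat.pow_le_pow_right (by norm_num) hK)
  rw [hardCoreThreshold, show ((B + 3 : ℕ) : ℝ) - 1 = ((B + 2 : ℕ) : ℝ) by push_cast; ring,
    show ((B + 3 : ℕ) : ℝ) - 2 = ((B + 1 : ℕ) : ℝ) by push_cast; ring, show B + 3 - 1 = B + 2 by omega,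
    Nat.cast_one, div_one, div_lt_iff₀ (by positivity)]
  exact_mod_cast hnat

/-- The code length `m ↦ 2 |bin (3m)| + 2 + 9m²` is strictly increasing. [folklore] -/
theorem strictMono_len : StrictMono fun m : ℕ => 2 * (encodeNat (3 * m)).length + 2 + 3 * m * (3 * m) := by
  refine Monotone.add_strictMono (fun a b hab => ?_) fun a b hab => Nat.mul_self_lt_mul_self (by omega)
  simp only [TM2Pass.length_encodeNat_eq_size]
  have := Nat.size_le_size (show 3 * a ≤ 3 * b by omega)
  omega

/-! ### The window -/

/-- **The counting window**, for any graph `G` on the positions of `annot 0 φ` whose adjacency is the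
conflict relation: with `K γ ≥ 6`, `K ≥ 3`, the hard-core count at `(B+3, 2^K, 1)` of the code of `G`
is `≥ 8 · 2^{Km-3}` if `φ` is satisfiable and in `(0, 2^{Km-3}]` if `val φ ≤ 1 - γ`. [folklore] -/
theorem window (B : ℕ) (γ : ℚ) (K : ℕ) (hK6 : (6 : ℚ) ≤ K * γ) (hK3 : 3 ≤ K) (φ : CNF ℕ)
    (h3 : φ.IsExactWidth 3) (hB : ∀ v : ℕ, (φ.countP fun cl => v ∈ cl.map Prod.fst) ≤ B)
    (hm : 0 < φ.length) (G : SimpleGraph (Fin (annot 0 φ).length))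
    (hadj : ∀ p q : Fin (annot 0 φ).length, G.Adj p q ↔ p ≠ q ∧
      (((annot 0 φ)[p].1 = (annot 0 φ)[q].1 ∧ (annot 0 φ)[p].2.1 ≠ (annot 0 φ)[q].2.1) ∨
        ((annot 0 φ)[p].2.1 = (annot 0 φ)[q].2.1 ∧ (annot 0 φ)[p].2.2 ≠ (annot 0 φ)[q].2.2))) :
    (φ.Satisfiable → 8 * 2 ^ (K * φ.length - 3) ≤
        hardcoreCount (B + 3) (2 ^ K) 1 (encodingGraph.encode ⟨(annot 0 φ).length, G⟩)) ∧
    (φ.maxSatFraction ≤ 1 - γ →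
        0 < hardcoreCount (B + 3) (2 ^ K) 1 (encodingGraph.encode ⟨(annot 0 φ).length, G⟩) ∧
        hardcoreCount (B + 3) (2 ^ K) 1 (encodingGraph.encode ⟨(annot 0 φ).length, G⟩) ≤
          2 ^ (K * φ.length - 3)) := by
  have h3' : ∀ c ∈ φ, c.length = 3 := fun c hc => (h3 c hc).1
  have hnd' : ∀ c ∈ φ, (c.map Prod.fst).Nodup := fun c hc => (h3 c hc).2
  have hmem := (annot_props φ).2 fun c hc h0 => by have := h3' c hc; simp [h0] at this
  have hlen : (annot 0 φ).length = 3 * φ.length := length_annot h3' 0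
  -- the promise `maxDegree ≤ Δ`
  have h2 : ∀ p : Fin (annot 0 φ).length,
      ((annot 0 φ).countP fun x => decide (x.2.1 = (annot 0 φ)[p].2.1)) ≤ B := fun p => by
    obtain ⟨i, -, l, -, hpl⟩ := (hmem _).1
      (show (annot 0 φ)[p] ∈ annot 0 φ by rw [Fin.getElem_fin]; exact List.getElem_mem p.isLt)
    rw [hpl]
    exact (countP_var_annot_le hnd' 0 l.1).trans (hB l.1)
  rw [hardcoreCount_encode_of_maxDegree_le (B + 3) (2 ^ K) 1 G
    (maxDegree_le hadj B (fun p => countP_fst_annot_le h3' 0 _) h2)]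
  refine ⟨fun hsat => ?_, fun hval => ?_⟩
  · -- YES: the term of an independent `m`-set
    obtain ⟨I, hI, hcard⟩ := exists_indepSet_of_satisfiable hadj hmem hsat
    have h := term_le_sum G (2 ^ K) 1 I hI
    rw [one_pow, mul_one, hcard, ← pow_mul] at h
    have h3K : 3 ≤ K * φ.length := le_trans (by norm_num) (Nat.mul_le_mul hK3 hm)
    calc 8 * 2 ^ (K * φ.length - 3) = 2 ^ (K * φ.length) := by
          rw [show (8 : ℕ) = 2 ^ 3 by norm_num, ← pow_add, Nat.add_sub_of_le h3K]
      _ ≤ _ := h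
  · -- NO: every independent set has `≤ s := ⌊(1-γ) m⌋` members, and `K s + 6 m ≤ K m`
    have hempty : G.IsIndepSet ↑(∅ : Finset (Fin (annot 0 φ).length)) := fun a ha => by simp at ha
    have hfracI : ∀ I : Finset (Fin (annot 0 φ).length), G.IsIndepSet ↑I →
        (I.card : ℚ) ≤ (1 - γ) * φ.length := fun I hI => by
      obtain ⟨σ, hσ⟩ := card_le_countP_of_isIndepSet hadj hmem (nodup_annot hnd' 0) I hI
      have hfrac := (CNF.satisfiedFraction_le_maxSatFraction φ σ).trans hval
      unfold CNF.satisfiedFraction CNF.numClauses at hfrac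
      rw [if_neg hm.ne', div_le_iff₀ (by exact_mod_cast hm)] at hfrac
      exact le_trans (by exact_mod_cast hσ) hfrac
    set s : ℕ := ⌊(1 - γ) * (φ.length : ℚ)⌋₊
    have hsle : (s : ℚ) ≤ (1 - γ) * φ.length := Nat.floor_le (by simpa using hfracI ∅ hempty)
    have hKs : K * s + 6 * φ.length ≤ K * φ.length := by
      have h1 : (6 * φ.length : ℚ) ≤ K * γ * φ.length := mul_le_mul_of_nonneg_right hK6 (by positivity)
      have h2 : (K : ℚ) * s ≤ K * ((1 - γ) * φ.length) := mul_le_mul_of_nonneg_left hsle K.cast_nonneg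
      have h4 : ((K * s + 6 * φ.length : ℕ) : ℚ) ≤ ((K * φ.length : ℕ) : ℚ) := by push_cast; linarith
      exact_mod_cast h4
    refine ⟨?_, ?_⟩
    · have h := term_le_sum G (2 ^ K) 1 ∅ hempty
      rwa [card_empty, pow_zero, one_mul, one_pow] at h
    · calc _ ≤ 2 ^ (annot 0 φ).length * (2 ^ K) ^ s :=
            sum_le G (2 ^ K) s Nat.one_le_two_pow fun I hI => Nat.le_floor (hfracI I hI)
        _ ≤ 2 ^ (K * φ.length - 3) := by
            rw [hlen, ← pow_mul, ← pow_add]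
            exact Nat.pow_le_pow_right (by norm_num) (by omega)

end ConflictGraphGap

/-- **S4b — the counting window on conflict graphs of bounded-occurrence E3-CNFs** (where the crux's
free `∃ Δ p q` is spent): `Δ := B + 3`, `q := 1`, `p := 2^K` with `K := max ⌈6/γ⌉₊ (B + 3)`,
`τ m := 2^{Km-3}`, `len m := 2 |bin (3m)| + 2 + 9m²`; the graph in the statement is the conflict graph
of `φ` on `KarpClique.annot 0 φ`; see `ConflictGraphGap.window` and the module docstring. [folklore] -/
theorem stub_conflictGraphGap : ∀ (B : ℕ) (γ : ℚ), 0 < γ →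
    ∃ (Δ p q : ℕ) (τ len : ℕ → ℕ), 3 ≤ Δ ∧ 0 < q ∧ hardCoreThreshold Δ < (p : ℝ) / q ∧ StrictMono len ∧
      ∀ φ : CNF ℕ, φ.IsExactWidth 3 → (∀ v : ℕ, (φ.countP fun cl => v ∈ cl.map Prod.fst) ≤ B) →
        0 < φ.length → ∀ x : List Bool,
        x = encodingGraph.encode ⟨(KarpClique.annot 0 φ).length,
          SimpleGraph.fromRel fun p q : Fin (KarpClique.annot 0 φ).length =>
            ((KarpClique.annot 0 φ)[p].1 = (KarpClique.annot 0 φ)[q].1 ∧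
                (KarpClique.annot 0 φ)[p].2.1 ≠ (KarpClique.annot 0 φ)[q].2.1) ∨
            ((KarpClique.annot 0 φ)[p].2.1 = (KarpClique.annot 0 φ)[q].2.1 ∧
                (KarpClique.annot 0 φ)[p].2.2 ≠ (KarpClique.annot 0 φ)[q].2.2)⟩ →
        x.length = len φ.length ∧
        (φ.Satisfiable → 8 * τ φ.length ≤ hardcoreCount Δ p q x) ∧
        (φ.maxSatFraction ≤ 1 - γ → 0 < hardcoreCount Δ p q x ∧ hardcoreCount Δ p q x ≤ τ φ.length) := by
  intro B γ hγ
  obtain ⟨K, hKB, hK6⟩ : ∃ K : ℕ, B + 3 ≤ K ∧ (6 : ℚ) ≤ K * γ := by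
    refine ⟨max ⌈(6 : ℚ) / γ⌉₊ (B + 3), le_max_right _ _, ?_⟩
    have h1 : (6 : ℚ) / γ ≤ (max ⌈(6 : ℚ) / γ⌉₊ (B + 3) : ℕ) :=
      (Nat.le_ceil _).trans (by exact_mod_cast le_max_left _ _)
    rwa [div_le_iff₀ hγ] at h1
  refine ⟨B + 3, 2 ^ K, 1, fun m => 2 ^ (K * m - 3),
    fun m => 2 * (encodeNat (3 * m)).length + 2 + 3 * m * (3 * m), by omega, Nat.one_pos,
    ConflictGraphGap.threshold_lt B K hKB, ConflictGraphGap.strictMono_len, ?_⟩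
  intro φ h3 hB hm x hx
  subst hx
  refine ⟨?_, ConflictGraphGap.window B γ K hK6 (by omega) φ h3 hB hm _ fun p q => ?_⟩
  · rw [encodingGraph_encode, length_boolPair, CliqueNP.encodingGraphFin_encode_eq, CliqueNP.length_adjBits]
    dsimp only
    rw [ConflictGraphGap.length_annot (fun c hc => (h3 c hc).1) 0]
  · rw [SimpleGraph.fromRel_adj]
    refine and_congr_right fun _ => ⟨fun h => h.elim id fun h' => ?_, Or.inl⟩
    exact h'.elim (fun h1 => Or.inl ⟨h1.1.symm, fun e => h1.2 e.symm⟩)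
      (fun h1 => Or.inr ⟨h1.1.symm, fun e => h1.2 e.symm⟩)

end Summit.PneNP.PneNP.Theorems
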